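import Summits.CriticalPhenomena.PercolationContinuityZ3.Theorems.PercNearOneGluingNoHeavyLowerTailOneCutModulus
import HarnessLib

/-!
# `NoHeavyLowerTail` (stmt-CriticalPhenomena-4575) — event gluing toward RELAY targets only (any modulus) closes the crux

Support file (lead gen 5; `--supports stmt-CriticalPhenomena-4575`).  No definitions, no named facts, no sorries.

`Theorems.noHeavyLowerTail_of_eventGluingConst` needs event gluing `P(o ↔ A, o ↮ c) ≤ C·s` toward EVERY target vertex `c`.  The crux
needs much less: it suffices that, in the near-one regime, `P(o ↔ A, o ↮ a')` is small for every RELAY `a' ∈ A` — with any modulus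
and no linearity — because then `P(o ↔ a') ≥ 1 − ε` for every relay, i.e. MEAN CONNECTION `E N ≥ (1 − ε)|A|`
(`Theorems.noHeavyLowerTail_of_meanConnection`).  This is the socket into which relay-target gluing theorems plug (lead memo LEAD-GEN5
§4b: e.g. depth-two observers satisfy `P(o ↔ A, o ↮ a') ≤ max_a P_{G−o}(a ↮ a')`).

* `noHeavyLowerTail_of_relayTargetGluing` — if for every `ε > 0` there is `τ > 0` such that every finite weighted graph with
  pairwise relay disconnections `≤ τ` and `P(o ↮ A) ≤ τ` has `P(o ↔ A, o ↮ a') ≤ ε` for every `a' ∈ A`, then `NoHeavyLowerTail`.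
-/

noncomputable section

namespace Summit.CriticalPhenomena.PercolationContinuityZ3.Theorems

open MeasureTheory Set Literature.Probability.LatticeModels Literature.Probability.Percolation
open scoped Classical BigOperators

/-- **Event gluing toward relay targets, with any modulus, implies `NoHeavyLowerTail`** (via mean connection:
`P(o ↮ a') ≤ P(o ↮ A) + P(o ↔ A, o ↮ a')`). [this work] -/
theorem noHeavyLowerTail_of_relayTargetGluing
    (hRT : ∀ ε : ℝ, 0 < ε → ∃ τ : ℝ, 0 < τ ∧ ∀ (n : ℕ) (w : Sym2 (Fin n) → unitInterval) (A : Finset (Fin n)) (o : Fin n),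
      (∀ a ∈ A, ∀ a' ∈ A, a ≠ a' → (prodBernoulli w).real (openConn a a' : Set (BondConfig (Fin n)))ᶜ ≤ τ) →
      (prodBernoulli w).real (⋃ a ∈ A, (openConn o a : Set (BondConfig (Fin n))))ᶜ ≤ τ →
      ∀ a' ∈ A, (prodBernoulli w).real ((⋃ a ∈ A, (openConn o a : Set (BondConfig (Fin n)))) ∩ (openConn o a')ᶜ) ≤ ε) :
    Summit.CriticalPhenomena.PercolationContinuityZ3.Theses.PercNearOneGluing.NoHeavyLowerTail := by
  refine noHeavyLowerTail_of_meanConnection fun ε hε => ?_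
  obtain ⟨τ₁, hτ₁, h⟩ := hRT (ε / 2) (by linarith)
  refine ⟨min τ₁ (ε / 2), lt_min hτ₁ (by linarith), fun n w A o hpair hU => ?_⟩
  set μ := prodBernoulli w with hμ
  have hτ₁' : ∀ a ∈ A, ∀ a' ∈ A, a ≠ a' → μ.real (openConn a a' : Set (BondConfig (Fin n)))ᶜ ≤ τ₁ :=
    fun a ha a' ha' hne => (hpair a ha a' ha' hne).trans (min_le_left _ _)
  have hU₁ : μ.real (⋃ a ∈ A, (openConn o a : Set (BondConfig (Fin n))))ᶜ ≤ τ₁ := hU.trans (min_le_left _ _)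
  have hUε : μ.real (⋃ a ∈ A, (openConn o a : Set (BondConfig (Fin n))))ᶜ ≤ ε / 2 := hU.trans (min_le_right _ _)
  -- every relay is reached with probability ≥ 1 − ε
  have hrelay : ∀ a' ∈ A, 1 - ε ≤ μ.real (openConn o a' : Set (BondConfig (Fin n))) := by
    intro a' ha'
    have hglue := h n w A o hτ₁' hU₁ a' ha'
    have hsub : (openConn o a' : Set (BondConfig (Fin n)))ᶜ ⊆
        (⋃ a ∈ A, (openConn o a : Set (BondConfig (Fin n))))ᶜ ∪
          ((⋃ a ∈ A, (openConn o a : Set (BondConfig (Fin n)))) ∩ (openConn o a')ᶜ) := by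
      intro ω hω
      by_cases hA : ω ∈ ⋃ a ∈ A, (openConn o a : Set (BondConfig (Fin n)))
      · exact Or.inr ⟨hA, hω⟩
      · exact Or.inl hA
    have hcompl : μ.real (openConn o a' : Set (BondConfig (Fin n)))ᶜ ≤ ε := by
      calc μ.real (openConn o a' : Set (BondConfig (Fin n)))ᶜ
          ≤ μ.real ((⋃ a ∈ A, (openConn o a : Set (BondConfig (Fin n))))ᶜ ∪
              ((⋃ a ∈ A, (openConn o a : Set (BondConfig (Fin n)))) ∩ (openConn o a')ᶜ)) :=
            measureReal_mono hsub (measure_ne_top _ _)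
        _ ≤ μ.real (⋃ a ∈ A, (openConn o a : Set (BondConfig (Fin n))))ᶜ +
              μ.real ((⋃ a ∈ A, (openConn o a : Set (BondConfig (Fin n)))) ∩ (openConn o a')ᶜ) :=
            measureReal_union_le _ _
        _ ≤ ε / 2 + ε / 2 := add_le_add hUε hglue
        _ = ε := by ring
    have hone : μ.real (openConn o a' : Set (BondConfig (Fin n))) +
        μ.real (openConn o a' : Set (BondConfig (Fin n)))ᶜ = 1 := by
      rw [measureReal_add_measureReal_compl (measurableSet_openConn_holds o a')]
      exact probReal_univ
    linarith
  calc (1 - ε) * (A.card : ℝ) = ∑ _a ∈ A, (1 - ε) := by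
        rw [Finset.sum_const, nsmul_eq_mul]; ring
    _ ≤ ∑ a ∈ A, μ.real (openConn o a : Set (BondConfig (Fin n))) := Finset.sum_le_sum hrelay

end Summit.CriticalPhenomena.PercolationContinuityZ3.Theorems

end
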